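import Literature.AlgebraicGeometry.Resolution.ExceptionalCurveDegree
import HarnessLib

/-!
# `(𝒪_X · E) = 0`: the trivial direction of Lipman 1969, Theorem (12.1) (i), for a Cartier divisor whose
# invertible sheaf has a nowhere-vanishing global section

Topic: `Literature/AlgebraicGeometry/Resolution`.  PROVED, fact-free, definition-free: the «⇐» half of the
named fact `Lipman1969_12_1_i` (`Lipman1969RationalSurfaceSingularities`), J. Lipman, *Rational singularities,
with applications to algebraic surfaces and unique factorization*, Publ. Math. IHÉS 36 (1969), Theorem (12.1) (i),
p. 220 (held copy `paper:doi-10-1007-bf02684604`, PDF p. 27):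

> «Let `A` be a local ring with maximal ideal `𝔪`, and let `f : X → Spec(A)` be a proper map whose fibres have
> dimension `≤ 1`.  Assume that `H¹(X, 𝒪_X) = 0`.  Let `ℒ` be an invertible `𝒪_X`-module.  Then: (i) `(ℒ·E) = 0`
> for all integral exceptional curves `E` on `X` if and only if `ℒ ≅ 𝒪_X`.»

The named fact renders «`ℒ ≅ 𝒪_X`» for `ℒ = 𝒪_X(D)` as «`𝒪_X(D)` has a global section `s` with `X_s = X`»
(`∃ s, D.IsSection s ∧ ∀ x, x ∈ D.nonvanishing s`).  The direction «⇐» needs none of the hypotheses (no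
`H¹ = 0`, no fibre dimension): a nowhere-vanishing section `s` exhibits `D ∼ 0` (`D + div(s)` has unit local
equations `f_i · s`), and the intersection number with an integral exceptional curve is a class invariant which
vanishes on the zero divisor (tree `excCurveDegree_congr_linEquiv`, `excCurveDegree_zero`).  The substantial
direction «⇒» (from `(ℒ·E) = 0` for all `E` to triviality, via `H¹ = 0` and the theorem on formal functions)
is NOT proved here; `Lipman1969_12_1_i` stays PRINT.

* `CartierDivisor.linEquiv_zero_of_forall_mem_nonvanishing` — a nowhere-vanishing global section makes `D ∼ 0`;
* `excCurveDegree_eq_zero_of_forall_mem_nonvanishing` — hence `(𝒪_X(D) · E_η) = 0` for every `η`;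
* `Lipman1969_12_1_i_mpr` — the «⇐» half of the named fact with its binders verbatim.

## References
* J. Lipman, Publ. Math. IHÉS 36 (1969), Theorem (12.1) (i), p. 220. [Lipman1969]
* U. Görtz, T. Wedhorn, *Algebraic Geometry I* (2nd ed., 2020), (11.9), Prop. 11.28 (`D ∼ E` iff
  `𝒪_X(D) ≅ 𝒪_X(E)`). [GortzWedhorn2020]
-/

noncomputable section

open CategoryTheory AlgebraicGeometry TopologicalSpace IsLocalRing
open Literature.AlgebraicGeometry.Motives

universe u

namespace Literature.AlgebraicGeometry.Motives.CartierDivisor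

/-- **A nowhere-vanishing global section trivialises**: if `s ∈ Γ(X, 𝒪_X(D))` has `X_s = X` (at every point
`x ∈ U_i` the rational function `f_i · s` is a unit of `𝒪_{X,x}`), then `D ∼ 0` — indeed `D + div(s)` has the
unit local equations `f_i · s`, i.e. is the same divisor as `0 = div(1)` (Görtz–Wedhorn I, Prop. 11.28:
`𝒪_X(D) ≅ 𝒪_X` iff `D` is principal). [cite: GortzWedhorn2020, Prop. 11.28 with Section (11.9) (p. 374)] -/
theorem linEquiv_zero_of_forall_mem_nonvanishing {X : Scheme.{u}} [IsIntegral X] (D : CartierDivisor X)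
    {s : X.functionField} (hs : ∀ x : X, x ∈ D.nonvanishing s) : D.LinEquiv 0 := by
  -- `s ≠ 0`: at any point, `f_i · s` is a unit of the local ring, in particular non-zero
  obtain ⟨x₀⟩ := (inferInstance : Nonempty X)
  have hs0 : s ≠ 0 := by
    obtain ⟨i, -, hu⟩ := hs x₀
    exact fun h => (RatFn.IsUnitAt.ne_zero hu) (by rw [h, mul_zero])
  refine ⟨s, hs0, fun p j x hp _ => ?_⟩
  change RatFn.IsUnitAt x (D.f p.1 * s / 1)
  rw [div_one]
  exact (D.mem_nonvanishing_iff hp.1).1 (hs x)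

end Literature.AlgebraicGeometry.Motives.CartierDivisor

namespace Literature.AlgebraicGeometry.Resolution

variable {T : Type u} [CommRing T] [IsLocalRing T] {X : Scheme.{u}} [IsIntegral X] [IsLocallyNoetherian X]
  (π : X ⟶ Spec (.of T)) [IsProper π]

/-- **`(𝒪_X(D) · E_η) = 0` when `𝒪_X(D)` has a nowhere-vanishing global section** (`𝒪_X(D) ≅ 𝒪_X`): the
intersection number is a class invariant (`excCurveDegree_congr_linEquiv`) and `D ∼ 0`.
[cite: Lipman1969, Theorem (12.1) (i) (p. 220), direction «⇐»] -/
theorem excCurveDegree_eq_zero_of_forall_mem_nonvanishing (D : CartierDivisor X) {s : X.functionField}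
    (hs : ∀ x : X, x ∈ D.nonvanishing s) {η : X} (hη : η ∈ excCurvePoints π) :
    excCurveDegree π D η = 0 := by
  rw [excCurveDegree_congr_linEquiv π hη (D.linEquiv_zero_of_forall_mem_nonvanishing hs)]
  exact excCurveDegree_zero π hη

omit [IsLocalRing T] [IsProper π] in
/-- **Lipman 1969, Theorem (12.1) (i), direction «⇐», fact-free** — with the binders of the named fact
`Lipman1969_12_1_i` verbatim (the hypotheses «fibres of dimension `≤ 1`» and «`H¹(X, 𝒪_X) = 0`» are idle in
this direction): if `𝒪_X(D)` has a global section `s` with `X_s = X`, then `(𝒪_X(D) · E) = 0` for every integral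
exceptional curve `E = E_η`. [cite: Lipman1969, Theorem (12.1) (i) (p. 220)] -/
theorem Lipman1969_12_1_i_mpr (A : Type u) [CommRing A] [IsNoetherianRing A] [IsLocalRing A]
    (X : Scheme.{u}) [IsIntegral X] [IsLocallyNoetherian X] (f : X ⟶ Spec (.of A)) [IsProper f]
    (_hfib : ∀ y : Spec (.of A), topologicalKrullDim (f.fiber y) ≤ 1) (_h1 : HasTrivialCechH1 f)
    (D : CartierDivisor X) :
    (∃ s : X.functionField, D.IsSection s ∧ ∀ x : X, x ∈ D.nonvanishing s) →
      ∀ η ∈ excCurvePoints f, excCurveDegree f D η = 0 := by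
  rintro ⟨s, -, hs⟩ η hη
  exact excCurveDegree_eq_zero_of_forall_mem_nonvanishing f D hs hη

end Literature.AlgebraicGeometry.Resolution


/-! ## Theorem (12.1) (ii), first equivalence, direction «⇐»: generated by global sections ⇒ `(ℒ·E) ≥ 0` -/

namespace Literature.AlgebraicGeometry.Motives.CartierDivisor

/-- **Moving `D` off a point by a section**: a global section `s` of `𝒪_X(D)` with `x ∈ X_s` gives the
effective divisor `D + div(s)` (local equations `f_i · s`, regular since `s` is a section), linearly equivalent
to `D` and avoiding `x` (`f_i · s` is a unit at `x`) — "the divisor of zeros of `s`".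
[cite: GortzWedhorn2020, Section (11.9) (p. 374) with Prop. 11.28] -/
theorem exists_isEffective_avoids_of_mem_nonvanishing {X : Scheme.{u}} [IsIntegral X] (D : CartierDivisor X)
    {s : X.functionField} (hs : D.IsSection s) {x : X} (hx : x ∈ D.nonvanishing s) :
    ∃ D' : CartierDivisor X, D.LinEquiv D' ∧ D'.IsEffective ∧ D'.Avoids x := by
  have hs0 : s ≠ 0 := by
    obtain ⟨i, -, hu⟩ := hx
    exact fun h => (RatFn.IsUnitAt.ne_zero hu) (by rw [h, mul_zero])
  refine ⟨D + principal s hs0, ⟨s, hs0, SameDivisor.refl _⟩, fun p y hp => hs p.1 y hp.1, fun p hp => ?_⟩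
  exact (D.mem_nonvanishing_iff hp.1).1 hx

end Literature.AlgebraicGeometry.Motives.CartierDivisor

namespace Literature.AlgebraicGeometry.Resolution

variable {T : Type u} [CommRing T] [IsLocalRing T] {X : Scheme.{u}} [IsIntegral X] [IsLocallyNoetherian X]
  (π : X ⟶ Spec (.of T)) [IsProper π]

/-- **`(𝒪_X(D) · E_η) ≥ 0` when `𝒪_X(D)` is generated by its global sections at `η`**: a section `s` with
`η ∈ X_s` moves `D` to an effective `D' ∼ D` avoiding `η`, and an effective divisor avoiding the generic point
of `E_η` meets it non-negatively (`excCurveDegree_nonneg_of_isEffective`, Lipman's Remark 2 c) after (12.1)).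
[cite: Lipman1969, Theorem (12.1) (ii) (p. 220), direction «⇐», with Section 12 Remark 2 c) (p. 221)] -/
theorem excCurveDegree_nonneg_of_mem_nonvanishing (D : CartierDivisor X) {s : X.functionField}
    (hs : D.IsSection s) {η : X} (hη : η ∈ excCurvePoints π) (hηs : η ∈ D.nonvanishing s) :
    0 ≤ excCurveDegree π D η := by
  obtain ⟨D', hDD', hD', hav⟩ := D.exists_isEffective_avoids_of_mem_nonvanishing hs hηs
  rw [excCurveDegree_congr_linEquiv π hη hDD']
  exact excCurveDegree_nonneg_of_isEffective π hη hD' hav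

omit [IsLocalRing T] [IsProper π] in
/-- **Lipman 1969, Theorem (12.1) (ii), first equivalence, direction «⇐», fact-free** — with the binders of the
named fact `Lipman1969_12_1_ii` verbatim (the hypotheses «fibres of dimension `≤ 1`» and «`H¹(X, 𝒪_X) = 0`» are
idle in this direction): if `𝒪_X(D)` is generated by its global sections (`IsGeneratedByGlobalSections D`), then
`(𝒪_X(D) · E) ≥ 0` for every integral exceptional curve `E = E_η`.  The converse and the vanishing
`H¹(𝒪_X(D)) = 0` are NOT proved here; `Lipman1969_12_1_ii` stays PRINT.
[cite: Lipman1969, Theorem (12.1) (ii) (p. 220)] -/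
theorem Lipman1969_12_1_ii_nonneg_of_isGeneratedByGlobalSections (A : Type u) [CommRing A]
    [IsNoetherianRing A] [IsLocalRing A] (X : Scheme.{u}) [IsIntegral X] [IsLocallyNoetherian X]
    (f : X ⟶ Spec (.of A)) [IsProper f] (_hfib : ∀ y : Spec (.of A), topologicalKrullDim (f.fiber y) ≤ 1)
    (_h1 : HasTrivialCechH1 f) (D : CartierDivisor X) :
    IsGeneratedByGlobalSections D → ∀ η ∈ excCurvePoints f, 0 ≤ excCurveDegree f D η := by
  intro hgen η hη
  obtain ⟨s, hs, hηs⟩ := hgen η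
  exact excCurveDegree_nonneg_of_mem_nonvanishing f D hs hη hηs

end Literature.AlgebraicGeometry.Resolution

end
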